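import Summits.MatrixMultiplication.MatrixMultiplication.Theorems.ObstructionDescentPrefixForm
import Summits.MatrixMultiplication.MatrixMultiplication.Theorems.ObstructionDescentGapOne
import Summits.MatrixMultiplication.MatrixMultiplication.Theorems.ObstructionDescentSlotFreeing

/- `set_option linter.dupNamespace false` as in the sibling kernel files (namespace `…Theorems.<FileStem>`). -/
set_option linter.dupNamespace false

/-!
# Obstruction descent — GAP PROPAGATION (K3c, decides the aside `GapPropagation`)

THEOREM (aside `GapPropagation`, item 27779 of route `ObstructionDescent`; memo NODE-g23 §3,
Theorem C).  Fix `N` and suppose GAP-ONE EMPTINESS holds from degree `d₀` on: every homogeneous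
polynomial of degree `d ≥ d₀` on `ℂ^N ⊗ ℂ^N ⊗ ℂ^N` vanishing on the tensors of rank `< d` is zero.
Then for `m < e` with `d₀ + e ≤ 2m + 2`, every homogeneous polynomial of degree `e` vanishing on
the tensors of rank `≤ m` is zero — i.e. `I_e(σ_m) = 0` in the whole window `m < e ≤ 2m + 2 − d₀`.

PROOF (slot freeing).  Polarise `f` to `P_f(y_1,…,y_e)` and regard it as a function `F` of `e`
TRIPLES `(u_i,v_i,w_i)` through the triads `u_i ⊗ v_i ⊗ w_i`.  (given) If the slots carry at most
`m` distinct triples, every `Σ c_i y_i` has rank `≤ m`, so `F = 0` (`polarForm_eq_zero_of_card_image_le`).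
(gap) Freeze the first `p` slots (`p + 2 ≤ 2(e − m)`), `n = e − p ≥ d₀`: if `F` vanishes whenever
the slots `p, p+1` carry the same triple, then the prefix polynomial `g` (K3b) of degree `n`
vanishes on rank `< n` (expand, pigeonhole two equal free slots, move them to `p, p+1` by the
symmetry of the prefix form), hence `g = 0` by gap-one emptiness, hence the prefix form vanishes
(re-polarisation, K3b), i.e. `F = 0` at the given tuple (`prefixPoly_eq_zero`).  The combinatorial
descent `M(2k;k) ⟸ … ⟸ M(0;0)` is the kernel `slotFreeing`; finally `F ≡ 0` on basis triples gives
`f = 0` by RECONSTRUCTION (K2b).  Edge cases: `N = 0` (no variables) and `e > 2m` (then `d₀ ≤ 1`,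
and gap-one emptiness in degree `1` is refuted by a coordinate function).

[this cell; LandsbergManivel2004 §3 (prolongation / polarisation), Raicu2012 Prop. 3.4,
LandsbergGCT2017 §8.3 — the statement itself (a uniform initial-degree bound for secant varieties of
the three-factor Segre from a single gap-one threshold) is this cell's]

STATUS: this file's `gapPropagation_holds` is the deciding theorem of route item
`stmt-MatrixMultiplication-27779` (`GapPropagation`, aside of `ObstructionDescent`): PROVED.
-/

namespace Summit.MatrixMultiplication.MatrixMultiplication.Theorems.ObstructionDescentGapPropagation

open MvPolynomial Finset
open ObstructionDescentPolarForm ObstructionDescentPolarLinear ObstructionDescentPolarExpand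
  ObstructionDescentPrefixForm ObstructionDescentGapOne ObstructionDescentSlotFreeing
open Literature.Computability.AlgebraicComplexity (triad triad_apply tensorRank tensorRank_le_card_of_eq_sum)

variable {N : ℕ}

/-- Triples of vectors `(u, v, w)`, the parameters of the triads `u ⊗ v ⊗ w`. [this cell] -/
abbrev Trip (N : ℕ) := (Fin N → ℂ) × (Fin N → ℂ) × (Fin N → ℂ)

/-- The triad of a triple, as a tensor on `Pt N`. [this cell] -/
def toT (x : Trip N) : Pt N → ℂ := tri x.1 x.2.1 x.2.2

/-- Every tensor is the sum of its `N³` coordinate triads. [this cell; Blaser2013 §4] -/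
theorem tensor_decomp (t : Fin N → Fin N → Fin N → ℂ) :
    t = ∑ q : Pt N, triad (fun a => if a = q.1 then t q.1 q.2.1 q.2.2 else 0)
      (fun b => if b = q.2.1 then (1 : ℂ) else 0) (fun c => if c = q.2.2 then (1 : ℂ) else 0) := by
  funext a b c
  simp only [Finset.sum_apply, triad_apply]
  rw [Finset.sum_eq_single (a, b, c)]
  · simp
  · intro q _ hq
    by_cases h1 : a = q.1
    · by_cases h2 : b = q.2.1
      · by_cases h3 : c = q.2.2
        · exfalso; apply hq; ext <;> simp [h1, h2, h3]
        · simp [h3]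
      · simp [h2]
    · simp [h1]
  · intro h; exact absurd (Finset.mem_univ _) h

/-- The rank is attained: a tensor is a sum of `R(t)` triads. [this cell; Blaser2013 §4] -/
theorem exists_decomp (t : Fin N → Fin N → Fin N → ℂ) :
    ∃ (w u v : Fin (tensorRank t) → Fin N → ℂ), t = ∑ i, triad (w i) (u i) (v i) := by
  have hne : {r : ℕ | ∃ (w u v : Fin r → Fin N → ℂ), t = ∑ i, triad (w i) (u i) (v i)}.Nonempty := by
    let e := Fintype.equivFin (Pt N)
    refine ⟨Fintype.card (Pt N),
      fun i a => if a = (e.symm i).1 then t (e.symm i).1 (e.symm i).2.1 (e.symm i).2.2 else 0,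
      fun i b => if b = (e.symm i).2.1 then (1 : ℂ) else 0,
      fun i c => if c = (e.symm i).2.2 then (1 : ℂ) else 0, ?_⟩
    exact (tensor_decomp t).trans (Fintype.sum_equiv e _ _ (fun q => by simp [e]))
  obtain ⟨w, u, v, h⟩ := Nat.sInf_mem hne
  exact ⟨w, u, v, h⟩

/-- (given) If the slots carry at most `m` distinct triples, the polar form vanishes — every
`Σ c_i y_i` has rank `≤ m`. [this cell] -/
theorem polarForm_eq_zero_of_card_image_le [DecidableEq (Trip N)] {e m : ℕ} (f : MvPolynomial (Pt N) ℂ)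
    (hvan : ∀ t : Fin N → Fin N → Fin N → ℂ, tensorRank t ≤ m →
      MvPolynomial.aeval (fun p : Pt N => t p.1 p.2.1 p.2.2) f = 0)
    (w : Fin e → Trip N) (hw : (univ.image w).card ≤ m) :
    polarForm f (fun i => toT (w i)) = 0 := by
  have hD : Dpoly f (fun i => toT (w i)) = 0 := by
    apply Dpoly_eq_zero_of_eval
    intro c
    set s := univ.image w with hs
    set T : Fin N → Fin N → Fin N → ℂ := fun a b d => ∑ k, c k * toT (w k) (a, b, d) with hT
    have hdec : T = ∑ x : ↥s, triad (fun a' => (∑ k ∈ univ.filter (fun k => w k = ↑x), c k) * (x.1).1 a')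
        (x.1).2.1 (x.1).2.2 := by
      funext a b d
      simp only [hT, Finset.sum_apply, triad_apply]
      rw [Finset.sum_coe_sort s (fun x : Trip N => (∑ k ∈ univ.filter (fun k => w k = x), c k) * x.1 a * x.2.1 b * x.2.2 d)]
      rw [← Finset.sum_fiberwise_of_maps_to (s := univ) (t := s) (g := w)
        (fun k _ => Finset.mem_image_of_mem w (Finset.mem_univ k))]
      refine Finset.sum_congr rfl fun x _ => ?_
      rw [Finset.sum_mul, Finset.sum_mul, Finset.sum_mul]
      refine Finset.sum_congr rfl fun k hk => ?_
      rw [(Finset.mem_filter.mp hk).2]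
      simp only [toT, tri]
      ring
    have hrank : tensorRank T ≤ m := by
      have h := tensorRank_le_card_of_eq_sum _ _ _ hdec
      rw [Fintype.card_coe] at h
      exact h.trans hw
    have h := hvan T hrank
    rw [aeval_eq_eval_pt] at h
    exact h
  rw [polarForm, hD, coeff_zero]

/-- A permutation of `Fin n` sending the first two indices to two prescribed distinct ones.
[this cell] -/
theorem exists_perm_zero_one {n : ℕ} (h2 : 2 ≤ n) (l₁ l₂ : Fin n) (hne : l₁ ≠ l₂) :
    ∃ τ : Equiv.Perm (Fin n), τ ⟨0, by omega⟩ = l₁ ∧ τ ⟨1, by omega⟩ = l₂ := by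
  set i0 : Fin n := ⟨0, by omega⟩ with hi0
  set i1 : Fin n := ⟨1, by omega⟩ with hi1
  have h01 : i0 ≠ i1 := by
    intro h; have := congrArg Fin.val h; simp [hi0, hi1] at this
  refine ⟨Equiv.swap i0 l₁ * Equiv.swap i1 (Equiv.swap i0 l₁ l₂), ?_, ?_⟩
  · rw [Equiv.Perm.mul_apply]
    have hs : Equiv.swap i0 l₁ l₂ ≠ i0 := by
      intro h
      apply hne
      have := congrArg (Equiv.swap i0 l₁) h
      rw [Equiv.swap_apply_self, Equiv.swap_apply_left] at this
      exact this.symm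
    rw [Equiv.swap_apply_of_ne_of_ne h01 hs.symm, Equiv.swap_apply_left]
  · rw [Equiv.Perm.mul_apply, Equiv.swap_apply_left, Equiv.swap_apply_self]

/-- (gap, analytic core) Under gap-one emptiness from degree `d₀`, with `2 ≤ n` and `d₀ ≤ n`: if the
prefix form with prefix `a` vanishes on every tuple of triads whose first two free slots carry the
same triple, then the prefix polynomial vanishes identically. [this cell] -/
theorem prefixPoly_eq_zero {d₀ p n : ℕ}
    (hGap : ∀ d : ℕ, d₀ ≤ d → ∀ g : MvPolynomial (Pt N) ℂ, g.IsHomogeneous d →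
      (∀ t : Fin N → Fin N → Fin N → ℂ, tensorRank t < d →
        MvPolynomial.aeval (fun q : Pt N => t q.1 q.2.1 q.2.2) g = 0) → g = 0)
    (f : MvPolynomial (Pt N) ℂ) (a : Fin p → Pt N → ℂ) (h2 : 2 ≤ n) (hdn : d₀ ≤ n)
    (HpA : ∀ c : Fin n → Trip N, c ⟨0, by omega⟩ = c ⟨1, by omega⟩ →
      polarForm f (Fin.append a (fun l => toT (c l))) = 0) :
    prefixPoly f a n = 0 := by
  classical
  apply hGap n hdn (prefixPoly f a n) (prefixPoly_isHomogeneous f a n)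
  intro t ht
  rw [aeval_prefixPoly]
  obtain ⟨w, u, v, hdec⟩ := exists_decomp t
  have hx : (fun q : Pt N => t q.1 q.2.1 q.2.2) = ∑ j : Fin (tensorRank t), toT (w j, u j, v j) := by
    funext q
    conv_lhs => rw [hdec]
    simp only [Finset.sum_apply, triad_apply, toT, tri]
  rw [hx, prefix_map_sum]
  refine Finset.sum_eq_zero fun σ _ => ?_
  obtain ⟨l₁, l₂, hne, heq⟩ := Fintype.exists_ne_map_eq_of_card_lt σ (by simpa using ht)
  obtain ⟨τ, hτ0, hτ1⟩ := exists_perm_zero_one h2 l₁ l₂ hne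
  rw [← polarForm_append_perm f a _ τ]
  exact HpA (fun j => (w (σ (τ j)), u (σ (τ j)), v (σ (τ j)))) (by simp only [hτ0, hτ1, heq])

/-- GAP PROPAGATION (decides the aside `GapPropagation`, item 27779): gap-one emptiness from degree
`d₀` propagates to `I_e(σ_m) = 0` for all `m < e ≤ 2m + 2 − d₀`. [this cell, NODE-g23 §3 Thm C] -/
theorem gapPropagation_holds :
    Summit.MatrixMultiplication.MatrixMultiplication.Theses.ObstructionDescent.GapPropagation := by
  intro N d₀ hGap m e hme hde f hf hvan
  classical
  rcases Nat.eq_zero_or_pos N with hN | hN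
  · -- no variables: a basis-index tuple `Fin e → Fin 0` cannot exist since `e ≥ 1`
    subst hN
    apply eq_zero_of_G3_eq_zero f hf
    intro α
    exact (Fin.elim0 (α ⟨0, by omega⟩) : ∀ β γ : Fin e → Fin 0, G3 f α β γ = 0)
  by_cases h2e : e ≤ 2 * m
  · -- MAIN CASE: slot freeing
    have hall : ∀ w : Fin e → Trip N, polarForm f (fun i => toT (w i)) = 0 := by
      refine slotFreeing (fun w : Fin e → Trip N => polarForm f (fun i => toT (w i))) m hme h2e ?_ ?_
      · intro w hw
        exact polarForm_eq_zero_of_card_image_le f hvan w hw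
      · intro p hp w Hp
        obtain ⟨n, hn⟩ : ∃ n, p + n = e := ⟨e - p, by omega⟩
        have hn2 : 2 ≤ n := by omega
        have hdn : d₀ ≤ n := by omega
        -- the analytic core in the `Fin (p + n)` world
        have key : prefixPoly f (fun i : Fin p => toT (w (Fin.cast hn (Fin.castAdd n i)))) n = 0 := by
          refine prefixPoly_eq_zero hGap f _ hn2 hdn ?_
          intro c hc
          -- the glued tuple of triples, indexed by `Fin e`
          have hF := Hp (fun i : Fin e => Fin.append (fun i' : Fin p => w (Fin.cast hn (Fin.castAdd n i'))) c
              (Fin.cast hn.symm i)) ?_ ?_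
          · -- transport `hF` to the `Fin (p + n)` world
            have hc' := polarForm_cast f hn (fun i : Fin e => toT (Fin.append
              (fun i' : Fin p => w (Fin.cast hn (Fin.castAdd n i'))) c (Fin.cast hn.symm i)))
            rw [hF] at hc'
            have happ : (Fin.append (fun i : Fin p => toT (w (Fin.cast hn (Fin.castAdd n i))))
                (fun l => toT (c l)))
                = fun i : Fin (p + n) => toT (Fin.append
                    (fun i' : Fin p => w (Fin.cast hn (Fin.castAdd n i'))) c
                    (Fin.cast hn.symm (Fin.cast hn i))) := by
              funext i
              have hi : Fin.cast hn.symm (Fin.cast hn i) = i := Fin.ext rfl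
              rw [hi]
              induction i using Fin.addCases with
              | left i' => simp only [Fin.append_left]
              | right j => simp only [Fin.append_right]
            rw [happ]
            exact hc'
          · -- prefix agreement
            intro i hi
            have h1 : Fin.cast hn.symm i = Fin.castAdd n ⟨i.val, hi⟩ := Fin.ext rfl
            simp only [h1, Fin.append_left]
            exact congrArg w (Fin.ext rfl)
          · -- doubled pair
            intro i j hi hj
            have h1 : Fin.cast hn.symm i = Fin.natAdd p ⟨0, by omega⟩ := Fin.ext (by simp [hi])
            have h2 : Fin.cast hn.symm j = Fin.natAdd p ⟨1, by omega⟩ := Fin.ext (by simp [hj])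
            simp only [h1, h2, Fin.append_right]
            exact hc
        have h3 := append_eq_zero_of_prefixPoly f _ key (fun j => toT (w (Fin.cast hn (Fin.natAdd p j))))
        rw [Fin.append_castAdd_natAdd (f := fun i : Fin (p + n) => toT (w (Fin.cast hn i)))] at h3
        rw [polarForm_cast f hn (fun i => toT (w i))] at h3
        exact h3
    apply eq_zero_of_G3_eq_zero f hf
    intro α β γ
    have h := hall (fun i => (dlt (α i), dlt (β i), dlt (γ i)))
    have hG : G3 f α β γ = polarForm f (fun i => toT (dlt (α i), dlt (β i), dlt (γ i))) := by
      simp only [G3, toT, basisTensor_eq_tri]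
    rw [hG]
    exact h
  · -- EDGE CASE `e > 2m`: then `d₀ ≤ 1`, and gap-one emptiness in degree 1 fails for `X q₀`
    exfalso
    have hd1 : d₀ ≤ 1 := by omega
    let q₀ : Pt N := (⟨0, hN⟩, ⟨0, hN⟩, ⟨0, hN⟩)
    have hX : (X q₀ : MvPolynomial (Pt N) ℂ) = 0 := by
      refine hGap 1 hd1 (X q₀) (isHomogeneous_X ℂ q₀) ?_
      intro t ht
      obtain ⟨w, u, v, hdec⟩ := exists_decomp t
      have ht0 : tensorRank t = 0 := by omega
      have h0 : t = 0 := by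
        rw [hdec]
        haveI : IsEmpty (Fin (tensorRank t)) := by rw [ht0]; infer_instance
        simp
      simp [h0]
    exact X_ne_zero q₀ hX

end Summit.MatrixMultiplication.MatrixMultiplication.Theorems.ObstructionDescentGapPropagation
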